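import Literature.NumberTheory.EllipticCurves.Kato2004.UniversalNormsIntegralProofs
import Literature.NumberTheory.EllipticCurves.Kato2004.IwasawaCohomologyExistsProofs
import Literature.NumberTheory.EllipticCurves.IwasawaAlgebraUnitTwist
import HarnessLib

/-!
# The `χ`-twist of Kato's pinned Iwasawa cohomology `𝐇¹_Γ(T_pW)` along layer identifications anti-commuting with
# `conj_γ` (`χ(γ) = −1`): `𝐇¹_Γ(T_pW') ↦ 𝐇¹_Γ(T_pW)` with the `Λ`-structure twisted by `Tw : (1+T) ↦ −(1+T)` — the
# `IwasawaH1Data` ADAPTER of the Γ-character twist (proofs only; 0 def, 0 fact)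

Topic `NumberTheory/EllipticCurves`, sub-directory `Kato2004` (namespace = path). THEOREMS ONLY: no definition, no named fact,
no `instance`, no notation, no `sorry`; nothing about any main conjecture or BSD is asserted.

**The point** (Rubin, *Euler systems* VI §1–2; Greenberg LNM 1716 §4 p. 107). The pin `Kato2004.IwasawaH1Data W p κ γ`
(file `IwasawaCohomology`) is `𝐇¹ = lim←_n H¹(ℤ_n[1/p], T_pW)` written levelwise: projections `proj n : 𝐇¹ → H¹(ℚ_n, T_pW)`,
integral values, trace-compatible, jointly bijective onto the norm-compatible integral families, `T = conj_γ − 1`. Suppose the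
LAYER groups of two curves `W', W` are identified from layer `1` on — additive isomorphisms
`ψ_n : H¹(ℚ_{n+1}, T_pW') ≃+ H¹(ℚ_{n+1}, T_pW)` (`n ≥ 0`), `ℤ_p`-linear, compatible with the trace maps, and ANTI-commuting
with `conj_γ` (`ψ(conj_γ y) = −conj_γ(ψ y)`: the twist by a character `χ` of `Γ` with `χ(γ) = −1`, trivial on `Gal(ℚ̄/ℚ₁)`;
at `p = 2`, `χ = χ₂`, `T₂W ≅ T₂W' ⊗ χ₂` for `W'` a model of `W^{(2)}` — NOT constructed here). Then every pin `I` of `W`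
yields a pin `I'` of `W'` on the SAME group with `Λ` acting through `Tw = PadicIntSeries.unitTwistEquiv (−1)`
(`‖(−1 : ℤ_p) − 1‖ < 1` forces `p = 2`), projections `ψ_n⁻¹ ∘ proj_{n+1}` and, at layer `0`, the TRACE of layer `1`
(layer `0` of `W'` is not identified with layer `0` of `W`; the inverse limit does not see it), with the identity
`e : I'.H ≃+ I.H` `Tw`-semilinear: `iwasawaH1Data_exists_negTwist`. Integrality of the new projections is automatic for the
CYCLOTOMIC tower (`mem_integralH1_of_layerCores_eq`, Kato Lemma 8.5 (2)); trace/`conj` commute by `layerCores_conjMap`.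
This is the `IwasawaH1Data`-half of the input «`Tw`-semilinear identification of the Kato carriers» of
`exists_multDivisibilityInputsContra_of_semilinear` (file `DivisibilityInputsContraSemilinearTransportProofs`), reduced to a
statement about the layer cohomology GROUPS; companion of the `SelmerDualData`-half `selmerDualData_exists_negTwist`
(file `IwasawaUnitTwistSelmerProofs`).

Motivation: cell `bsd-2adic`, seat `k4-w3` GEN 2, crux stmt-BirchSwinnertonDyer-22618 C4″, reading R15 (iii).

## References
* [Rubin2000] K. Rubin, *Euler systems*, Ch. VI §1–§2 (twisting Euler systems and Iwasawa cohomology by characters of `Γ`),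
  App. B Prop. B.3.3.
* [GreenbergLNM1716] R. Greenberg, LNM 1716 (1999), §4 p. 107.
* [Kato2004Asterisque] K. Kato, Astérisque 295, §8.2 and Lemma 8.5 (pp. 180–184), §12.2 (p. 220).
-/

noncomputable section

open scoped NumberField
open Field
open Literature.NumberTheory.GaloisRepresentations
open Literature.NumberTheory.EllipticCurves Literature.NumberTheory.EllipticCurves.IwasawaAlgebra
  Literature.NumberTheory.EllipticCurves.PadicIntSeries
  Literature.NumberTheory.EllipticCurves.Kato2004.EulerSystemValues

namespace Literature.NumberTheory.EllipticCurves.Kato2004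

section NegTwist

variable {W W' : WeierstrassCurve ℚ} [W.IsElliptic] [W'.IsElliptic] {p : ℕ} [Fact p.Prime]
  [ContinuousSMul ℤ_[p] (W.tateModule p)] [ContinuousSMul ℤ_[p] (W'.tateModule p)]
  {κ : ZpExtension ℚ p} {γ : absoluteGaloisGroup ℚ}

/-- **The `χ`-twist (`χ(γ) = −1`) of the pinned Iwasawa cohomology along layer identifications.** Let `κ` be cyclotomic,
`‖(−1 : ℤ_p) − 1‖ < 1`, and `ψ_n : H¹(ℚ_{n+1}, T_pW') ≃+ H¹(ℚ_{n+1}, T_pW)` (`n ≥ 0`) be `ℤ_p`-linear, trace-compatible and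
anti-commuting with `conj_γ`. Then every `I : IwasawaH1Data W p κ γ` gives `I' : IwasawaH1Data W' p κ γ` with `I'.H = I.H` as a
group, `Λ` acting through `Tw = unitTwistEquiv (−1)`, `I'.proj (n+1) = ψ_n⁻¹ ∘ I.proj (n+1)`, `I'.proj 0 = Cor ∘ I'.proj 1`, and the
identity `e : I'.H ≃+ I.H` is `Tw`-semilinear (`e(r • x) = Tw(r) • e(x)`). Check of `T ↦ conj_γ − 1`: `Tw(T) = −2 − T` and
`ψ⁻¹(conj_γ(ψ z)) = −conj_γ z`. [cite: Rubin2000, Ch. VI §1–§2] [cite: GreenbergLNM1716, §4 (p. 107)]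
[cite: Kato2004Asterisque, §12.2 (p. 220), Lemma 8.5 (2) (p. 183)] -/
theorem iwasawaH1Data_exists_negTwist (h1 : ‖(-1 : ℤ_[p]) - 1‖ < 1) (hκ : κ.IsCyclotomic)
    (ψ : ∀ n : ℕ, H1 (tateRep W' p) (κ.layerSubgroup (n + 1)) ≃+ H1 (tateRep W p) (κ.layerSubgroup (n + 1)))
    (hψ_smul : ∀ (n : ℕ) (c : ℤ_[p]) (y : H1 (tateRep W' p) (κ.layerSubgroup (n + 1))),
      ψ n (c • y) = c • ψ n y)
    (hψ_cores : ∀ (n : ℕ) (y : H1 (tateRep W' p) (κ.layerSubgroup (n + 2))),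
      layerCores (tateRep W p) κ (n + 1) (ψ (n + 1) y) = ψ n (layerCores (tateRep W' p) κ (n + 1) y))
    (hψ_conj : ∀ (n : ℕ) (y : H1 (tateRep W' p) (κ.layerSubgroup (n + 1))),
      ψ n (conjMap (tateRep W' p).toTopRep (κ.layerSubgroup (n + 1)) γ 1 y) =
        -conjMap (tateRep W p).toTopRep (κ.layerSubgroup (n + 1)) γ 1 (ψ n y))
    (I : IwasawaH1Data W p κ γ) :
    ∃ (I' : IwasawaH1Data W' p κ γ) (e : I'.H ≃+ I.H),
      (∀ (r : IwasawaAlgebra p) (x : I'.H), e (r • x) = unitTwist r (-1) • e x) ∧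
      (∀ (n : ℕ) (x : I'.H), ψ n (I'.proj (n + 1) x) = I.proj (n + 1) (e x)) ∧
      (∀ x : I'.H, I'.proj 0 x = layerCores (tateRep W' p) κ 0 (I'.proj 1 x)) := by
  -- `Tw` as a ring automorphism of `Λ`
  set θ : IwasawaAlgebra p ≃+* IwasawaAlgebra p := unitTwistEquiv (-1) h1 with hθ
  have hθ_apply : ∀ r : IwasawaAlgebra p, θ r = unitTwist r (-1) := fun r ↦ rfl
  have hθX : θ PowerSeries.X = -2 - PowerSeries.X := by
    rw [hθ_apply, unitTwist_X h1]
    have h2 : ((-1 : ℤ_[p]) - 1) = -2 := by norm_num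
    rw [h2, map_neg, map_neg, map_one, show (PowerSeries.C (2 : ℤ_[p]) : IwasawaAlgebra p) = 2 from map_ofNat _ 2]
    ring
  -- `ψ⁻¹` is `ℤ_p`-linear and anti-commutes with `conj_γ`
  have hψ_smul' : ∀ (n : ℕ) (c : ℤ_[p]) (z : H1 (tateRep W p) (κ.layerSubgroup (n + 1))),
      (ψ n).symm (c • z) = c • (ψ n).symm z := fun n c z ↦ by
    apply (ψ n).injective
    rw [AddEquiv.apply_symm_apply, hψ_smul, AddEquiv.apply_symm_apply]
  have hψ_conj' : ∀ (n : ℕ) (z : H1 (tateRep W p) (κ.layerSubgroup (n + 1))),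
      (ψ n).symm (conjMap (tateRep W p).toTopRep (κ.layerSubgroup (n + 1)) γ 1 z) =
        -conjMap (tateRep W' p).toTopRep (κ.layerSubgroup (n + 1)) γ 1 ((ψ n).symm z) := fun n z ↦ by
    apply (ψ n).injective
    rw [AddEquiv.apply_symm_apply, map_neg, hψ_conj, neg_neg, AddEquiv.apply_symm_apply]
  -- the new projections: `ψ_n⁻¹ ∘ proj_{n+1}` from layer `1` on, the trace of layer `1` at layer `0`
  let projSucc : ∀ n : ℕ, I.H →+ H1 (tateRep W' p) (κ.layerSubgroup (n + 1)) :=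
    fun n ↦ (ψ n).symm.toAddMonoidHom.comp (I.proj (n + 1))
  let proj' : ∀ n : ℕ, I.H →+ H1 (tateRep W' p) (κ.layerSubgroup n) := fun n ↦
    match n with
    | 0 => (layerCores (tateRep W' p) κ 0).toAddMonoidHom.comp (projSucc 0)
    | n + 1 => projSucc n
  have hproj'_zero : ∀ x, proj' 0 x = layerCores (tateRep W' p) κ 0 ((ψ 0).symm (I.proj 1 x)) := fun x ↦ rfl
  have hproj'_succ : ∀ n x, proj' (n + 1) x = (ψ n).symm (I.proj (n + 1) x) := fun n x ↦ rfl
  -- trace compatibility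
  have hcores' : ∀ (n : ℕ) (x : I.H), layerCores (tateRep W' p) κ n (proj' (n + 1) x) = proj' n x := by
    intro n x
    cases n with
    | zero => rfl
    | succ m =>
      rw [hproj'_succ, hproj'_succ]
      apply (ψ m).injective
      rw [← hψ_cores, AddEquiv.apply_symm_apply, AddEquiv.apply_symm_apply, I.cores_proj]
  -- `T ↦ conj_γ − 1` on the layers `n + 1`, then on layer `0` by the trace
  have hT_succ : ∀ (n : ℕ) (x : I.H), proj' (n + 1) (θ PowerSeries.X • x) =
      conjMap (tateRep W' p).toTopRep (κ.layerSubgroup (n + 1)) γ 1 (proj' (n + 1) x) - proj' (n + 1) x := by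
    intro n x
    rw [hproj'_succ, hproj'_succ, hθX, sub_smul, neg_smul, two_smul, map_sub, map_neg, map_add, I.proj_T_smul,
      map_sub, map_neg, map_add, map_sub, hψ_conj']
    abel
  have hT : ∀ (n : ℕ) (x : I.H), proj' n (θ PowerSeries.X • x) =
      conjMap (tateRep W' p).toTopRep (κ.layerSubgroup n) γ 1 (proj' n x) - proj' n x := by
    intro n x
    cases n with
    | zero =>
      rw [← hcores' 0, hT_succ 0 x, map_sub, IwasawaH1Exists.layerCores_conjMap, hcores' 0]
    | succ m => exact hT_succ m x
  -- constants
  have hC : ∀ (c : ℤ_[p]) (n : ℕ) (x : I.H), proj' n (θ (PowerSeries.C c) • x) = c • proj' n x := by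
    intro c n x
    rw [hθ_apply, unitTwist_C c h1]
    cases n with
    | zero => rw [hproj'_zero, hproj'_zero, I.proj_C_smul, hψ_smul', map_smul]
    | succ m => rw [hproj'_succ, hproj'_succ, I.proj_C_smul, hψ_smul']
  -- the twisted pin
  refine ⟨@IwasawaH1Data.mk W' _ p _ _ κ γ I.H I.addCommGroup (Module.compHom I.H θ.toRingHom) proj' ?_ hcores' ?_ ?_
      (fun n x ↦ hT n x) (fun c n x ↦ hC c n x), AddEquiv.refl I.H, fun r x ↦ rfl, fun n x ↦ ?_, fun x ↦ rfl⟩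
  · -- integrality: automatic for a trace-compatible family along the cyclotomic tower (Kato Lemma 8.5 (2))
    intro n x
    exact UniversalNorms.mem_integralH1_of_layerCores_eq W' p κ hκ (fun m ↦ proj' m x) (fun m ↦ hcores' m x) n
  · -- injectivity
    intro x hx
    refine I.proj_injective x fun n ↦ ?_
    cases n with
    | zero => rw [← I.cores_proj 0 x]; have h1' := hx 1; rw [hproj'_succ] at h1'
              rw [show I.proj 1 x = 0 from by simpa using congrArg (ψ 0) h1', map_zero]
    | succ m => have h := hx (m + 1); rw [hproj'_succ] at h; simpa using congrArg (ψ m) h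
  · -- surjectivity onto the norm-compatible integral families of `W'`
    intro y' hy'
    -- the transported family for `W`
    let y : ∀ n : ℕ, H1 (tateRep W p) (κ.layerSubgroup n) := fun n ↦
      match n with
      | 0 => layerCores (tateRep W p) κ 0 (ψ 0 (y' 1))
      | n + 1 => ψ n (y' (n + 1))
    have hy_cores : ∀ n, layerCores (tateRep W p) κ n (y (n + 1)) = y n := by
      intro n
      cases n with
      | zero => rfl
      | succ m =>
        change layerCores (tateRep W p) κ (m + 1) (ψ (m + 1) (y' (m + 2))) = ψ m (y' (m + 1))
        rw [hψ_cores, hy'.2 (m + 1)]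
    have hy : IsNormCompatible (tateRep W p) κ y :=
      ⟨fun n ↦ UniversalNorms.mem_integralH1_of_layerCores_eq W p κ hκ y hy_cores n, hy_cores⟩
    obtain ⟨x, hx⟩ := I.proj_surjective y hy
    refine ⟨x, fun n ↦ ?_⟩
    cases n with
    | zero =>
      rw [hproj'_zero, hx 1]
      change layerCores (tateRep W' p) κ 0 ((ψ 0).symm (ψ 0 (y' 1))) = y' 0
      rw [AddEquiv.symm_apply_apply, hy'.2 0]
    | succ m =>
      rw [hproj'_succ, hx (m + 1)]
      change (ψ m).symm (ψ m (y' (m + 1))) = y' (m + 1)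
      rw [AddEquiv.symm_apply_apply]
  · -- `ψ_n ∘ I'.proj (n+1) = I.proj (n+1)`
    change ψ n ((ψ n).symm (I.proj (n + 1) x)) = I.proj (n + 1) x
    rw [AddEquiv.apply_symm_apply]

end NegTwist

end Literature.NumberTheory.EllipticCurves.Kato2004

end
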